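import Summits.BirchSwinnertonDyer.BirchSwinnertonDyer.Theorems.ErratumRoadFiveEulerHalfGenusSharpKolyvaginPointDiv
import HarnessLib

/-!
# Kolyvagin's class does not depend on the admissible module: (D″) «`P_m ∈ p^{min(M,t)}·A′_m` for a LARGER
# admissible module `A′_m ⊇ A_m`» ⟹ (D) «`p^{M−t}·c_M(P_m) = 0`»
# (crux stmt-BirchSwinnertonDyer-23444 `EulerHalfPOnlyMultPotMultTwinAtFive`, line `genus`, S4♯ residual (b); helper)

Seat `bsd-idea-9` (D-0154 §B ideator, lens complete), sequel of p690302
(`ErratumRoadFiveEulerHalfGenusSharpKolyvaginPointDiv`), offered `--supports stmt-BirchSwinnertonDyer-23444 --as helper`.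

## Why (a correction of the seat's own (D′) currency, genus v1.4 §1c)

In the `E′`-datum of S4♯ (`GenusKolyvaginEprimePointsR`, genus v1.3) ONE family of admissible modules `A_m ⊆ W(K̄)`
carries both the Néron-component clause (E′) «`n′·(A_m)_v ⊆ W⁰(K̄_v)` at `v ∣ p`» and McCallum's classes.  (E′) forces
`A_m` SMALL (the `ℤ[𝒢_m]`-span of the transported CM points: at the split multiplicative `p` with `p ∣ c_p` the full
group `W(K[m])` meets every component), whereas Kolyvagin–McCallum–Jetchev divisibility «`P_m ∈ p^{m_∞} E(K_m)`»
(McCallum 1991 (5)–(6); Jetchev 2008 Thm. 1.4) produces the root in the BIG module `W(K[m])`.  The point-divisibility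
clause must therefore be allowed a larger admissible module `A′_m ⊇ A_m` than the one carrying (E′) and the classes.
This is harmless because Kolyvagin's class `c_M(P)` is INDEPENDENT of the admissible module used to extract the roots
`(g−1)P/p^M` (uniqueness of roots in a `p^M`-torsion-free group, McCallum 1991 Lemma 4.1): proved here.

## What (THEOREMS ONLY — no `def`, no named fact, no `sorry`)

* `invPoints_mono`, `rootIn_eq_rootIn_of_le`, `cls_eq_cls_of_le` — generic (`G`-module `M`, `A ≤ A′`).
* `kolyvaginClass_eq_of_le` — `c_A(P) = c_{A′}(P)` in `H¹(K, E[n])` for admissible `A ≤ A′`, `P ∈ invPoints A`.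
* `pow_sub_zsmul_kolyvaginClass_eq_zero_of_pointDiv_of_le` — (D″) ⟹ (D): `R ∈ A′ ⊇ A`, `p^{min(M,t)}·R = P`
  ⟹ `p^{M−t}·c_{M,A}(P) = 0`.
* `padicValNat_card_sha_add_le_of_ringClassRationalEprimePointsDiv'` — VERBATIM p690302's
  `…EprimePointsDiv` with its last clause widened to (D″) «`∃ A′ ⊇ A m` admissible, `∃ R ∈ A′`, `p^{min M t}·R = P_m`»;
  PROVED by rebuilding genus-p2's `hR` (clause (D) by the lemma above).

## Honest framing

CONDITIONAL on the displayed binders: neither (D″) nor (E′) for the genus system is proved here; S4♯ ∕ S4♭ and item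
23444 stay OPEN; no summit statement is proved by this seat; BSD is proved for no curve.

## References

[cite: McCallumLMS1991, Lemma 4.1, §4 (5)–(6), Cor. 4.5, §5 Cor. 5.6] [cite: GrossLMS1991, §4 (4.4), (4.6), Prop. 4.7 (1)]
[cite: Jetchev2008, Thm. 1.4, Cor. 1.5] [cite: GrossZagier1986, III (3.1)]
presearch: «Kolyvagin class independent of the choice of E(K_n) ⊆ A ⊆ E(K̄) (uniqueness of p^M-th roots)» → tree
`KolyvaginCocycle.rootIn_eq`, `cls_eq_of_root`, `oneCocycleClass_congr_val` (`HeegnerPointsKolyvaginPrimaryClassesProofs`);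
corpus [corpus: book:editornd-l-functions-arithmetic p0242 (Gross §4 (4.6) "the unique p-th root … in E(K_n)")];
galaxy: none needed (folklore algebra).
-/

noncomputable section

open scoped Classical

-- every file of `Summits/BirchSwinnertonDyer/BirchSwinnertonDyer/Theorems/` lives in this namespace
set_option linter.dupNamespace false
set_option autoImplicit false

namespace Summit.BirchSwinnertonDyer.BirchSwinnertonDyer.Theorems.GenusSharpKolyvagin

open WeierstrassCurve NumberField IsDedekindDomain Field
  Literature.NumberTheory.EllipticCurves Literature.NumberTheory.EllipticCurves.KolyvaginCocycle
  Literature.NumberTheory.EllipticCurves.RingClassField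
  Literature.NumberTheory.GaloisRepresentations Literature.NumberTheory.NumberFields
  Literature.NumberTheory.DiophantineGeometry
  Summit.BirchSwinnertonDyer.Rank1Residual.X11b
  Summit.BirchSwinnertonDyer.BirchSwinnertonDyer.Theorems

universe u

/-! ## §1 Generic: a larger `n`-torsion-free module extracts the same roots -/

section Module

variable {G : Type*} [Group G] {M : Type*} [AddCommGroup M] [DistribMulAction G M]

/-- `invPoints` is monotone in the module. [folklore] -/
theorem invPoints_mono {A A' : AddSubgroup M} (h : A ≤ A') (n : ℤ) :
    invPoints G A n ≤ invPoints G A' n := by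
  intro P hP
  refine ⟨h hP.1, fun g ↦ ?_⟩
  obtain ⟨R, hR, hRe⟩ := hP.2 g
  exact ⟨R, h hR, hRe⟩

/-- The `n`-th root of `x ∈ nA` computed in a larger `n`-torsion-free `A′ ⊇ A` is the one computed in `A`
(McCallum 1991, Lemma 4.1: uniqueness). [cite: McCallumLMS1991, Lemma 4.1] -/
theorem rootIn_eq_rootIn_of_le {A A' : AddSubgroup M} (h : A ≤ A') {n : ℤ}
    (hA'n : ∀ ⦃a : M⦄, a ∈ A' → n • a = 0 → a = 0) {x : M} (hx : ∃ R ∈ A, n • R = x) :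
    rootIn A' n x = rootIn A n x :=
  rootIn_eq hA'n (h (rootIn_spec hx).1) (rootIn_spec hx).2

end Module

section Cls

variable {G : Type u} [Group G] [TopologicalSpace G] [IsTopologicalGroup G]
  {M : Type u} [AddCommGroup M] [DistribMulAction G M] [TopologicalSpace M] [DiscreteTopology M]

/-- **McCallum's class is independent of the admissible module**: for admissible `A ≤ A′` and `P ∈ invPoints A`,
the cocycles `g ↦ gQ − Q − (g−1)P/n` built with roots in `A` and in `A′` are literally equal.
[cite: McCallumLMS1991, Lemma 4.1] [cite: GrossLMS1991, §4 (4.6)] -/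
theorem cls_eq_cls_of_le {A A' : AddSubgroup M} (h : A ≤ A') {n : ℤ} (hA : IsAdmissible G A n)
    (hA' : IsAdmissible G A' n) (hcont : ∀ m : M, Continuous fun g : G ↦ g • m) {P : M}
    (hP : P ∈ invPoints G A n) {Q : M} (hQ : n • Q = P) :
    cls hA hcont hP hQ = cls hA' hcont (invPoints_mono h n hP) hQ := by
  unfold cls
  refine oneCocycleClass_congr_val fun g ↦ ?_
  rw [coe_cocycle_apply, coe_cocycle_apply, rootIn_eq_rootIn_of_le h hA'.eq_zero_of_zsmul (hP.2 g)]

end Cls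

/-! ## §2 Kolyvagin's class `c(P) ∈ H¹(K, E[n])` and the widened point-divisibility clause (D″) -/

/-- **`c_A(P) = c_{A′}(P)`** for admissible `A ≤ A′ ⊆ E(K̄)` and `P ∈ invPoints A` (same chosen root `P/n`).
[cite: McCallumLMS1991, Lemma 4.1] [cite: GrossLMS1991, §4 (4.4), (4.6)] -/
theorem kolyvaginClass_eq_of_le {K : Type u} [Field K] (V : WeierstrassCurve K) {n : ℤ}
    {hdiv : ∀ P : geomPoints V, ∃ Q : geomPoints V, n • Q = P}
    {A A' : AddSubgroup (geomPoints V)} (h : A ≤ A')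
    (hA : IsAdmissible (absoluteGaloisGroup K) A n) (hA' : IsAdmissible (absoluteGaloisGroup K) A' n)
    {P : geomPoints V} (hP : P ∈ invPoints (absoluteGaloisGroup K) A n) :
    kolyvaginClass V n hdiv hA P hP = kolyvaginClass V n hdiv hA' P (invPoints_mono h n hP) := by
  obtain ⟨Q, hQ⟩ := hdiv P
  rw [kolyvaginClass_eq_cls hA hP hQ, kolyvaginClass_eq_cls hA' _ hQ]
  exact cls_eq_cls_of_le h hA hA' _ hP hQ

/-- **(D″) ⟹ (D) at level `p^M`**: if `P ∈ invPoints A` and `p^{min(M,t)}·R = P` for some `R` in a LARGER admissible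
module `A′ ⊇ A` (printed: `R ∈ E(K_m)`, the root of McCallum's (5)–(6) ∕ Jetchev's global divisibility, while `A`
is the CM module carrying the Néron-component clause), then `p^{M−t}·c_{M,A}(P) = 0`.
[cite: McCallumLMS1991, §4 (5)–(6), Cor. 4.5] [cite: GrossLMS1991, Prop. 4.7 (1)] [cite: Jetchev2008, Thm. 1.4] -/
theorem pow_sub_zsmul_kolyvaginClass_eq_zero_of_pointDiv_of_le {K : Type u} [Field K] (V : WeierstrassCurve K)
    {p M t : ℕ} {hdiv : ∀ P : geomPoints V, ∃ Q : geomPoints V, ((p ^ M : ℕ) : ℤ) • Q = P}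
    {A A' : AddSubgroup (geomPoints V)} (h : A ≤ A')
    (hA : IsAdmissible (absoluteGaloisGroup K) A ((p ^ M : ℕ) : ℤ))
    (hA' : IsAdmissible (absoluteGaloisGroup K) A' ((p ^ M : ℕ) : ℤ))
    {P : geomPoints V} (hP : P ∈ invPoints (absoluteGaloisGroup K) A ((p ^ M : ℕ) : ℤ))
    (hD : ∃ R ∈ A', ((p ^ min M t : ℕ) : ℤ) • R = P) :
    ((p : ℤ) ^ (M - t)) • kolyvaginClass V _ hdiv hA P hP = 0 := by
  rw [kolyvaginClass_eq_of_le V h hA hA' hP]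
  exact pow_sub_zsmul_kolyvaginClass_eq_zero_of_pointDiv V hA' _ hD

variable (W : WeierstrassCurve ℚ) {K : Type} [Field K] [NumberField K]

/-- **S4♭'s inequality from the (D″)-datum** — VERBATIM p690302's
`padicValNat_card_sha_add_le_of_ringClassRationalEprimePointsDiv` with the last clause of `hR` WIDENED to
(D″) «`∃ A′ ⊇ A m` admissible, `∃ R ∈ A′`, `p^{min M t}·R = P_m`» (the module of the classes and of the carrier clause
(E′) stays `A m`).  Proof: rebuild genus-p2's `hR`, clause (D) by `pow_sub_zsmul_kolyvaginClass_eq_zero_of_pointDiv_of_le`,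
and apply `padicValNat_card_sha_add_le_of_ringClassRationalEprimePoints`.  Conditional on the displayed binders; (D″) and
(E′) are NOT proved here.  [cite: McCallumLMS1991, §4 (5)–(6), §5 Cor. 5.6] [cite: GrossLMS1991, Prop. 4.7 (1), Prop. 6.2 (1)]
[cite: Jetchev2008, Thm. 1.4, Cor. 1.5] [cite: GrossZagier1986, III (3.1)] -/
theorem padicValNat_card_sha_add_le_of_ringClassRationalEprimePointsDiv' [W.IsElliptic]
    (hK : IsImaginaryQuadratic K) (ιc : K →+* ℂ) {p : ℕ} [Fact p.Prime] (hp2 : p ≠ 2)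
    (hρ : W.HasSurjectiveModNGaloisRep p)
    {Pt : (W.baseChange K).toAffine.Point} (hnt : ¬ IsOfFinAddOrder Pt)
    (hidx : (AddSubgroup.zmultiples Pt).index ≠ 0) (t : ℕ) {n' : ℤ} (hn' : IsCoprime (p : ℤ) n')
    (hL : ∀ {m : ℕ} (_hm : m ≠ 0) (e : ringClassField K ιc m →ₐ[K] AlgebraicClosure K)
      (_hKol : ∀ q ∈ m.primeFactors, IsKolyvaginPrime (W.conductorNorm ℤ) W K p q)
      {M : ℕ} {hdiv : ∀ P : geomPoints (W.baseChange K), ∃ Q, ((p ^ M : ℕ) : ℤ) • Q = P}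
      {A : AddSubgroup (geomPoints (W.baseChange K))}
      (hA : KolyvaginCocycle.IsAdmissible (Field.absoluteGaloisGroup K) A ((p ^ M : ℕ) : ℤ))
      (_hArat : ∀ a ∈ A, ∀ Φ : Field.absoluteGaloisGroup K,
        (∀ x : ringClassField K ιc m, Φ • e x = e x) → Φ • a = a)
      {P : geomPoints (W.baseChange K)}
      (hP : P ∈ KolyvaginCocycle.invPoints (Field.absoluteGaloisGroup K) A ((p ^ M : ℕ) : ℤ))
      (v : HeightOneSpectrum (𝓞 K)) (_hv : ((m : ℕ) : 𝓞 K) ∉ v.asIdeal) (_hvp : ((p : ℕ) : 𝓞 K) ∉ v.asIdeal),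
      kolyvaginClass (W.baseChange K) ((p ^ M : ℕ) : ℤ) hdiv hA P hP ∈
        selmerLocalKer (W.baseChange K) (v.adicCompletion K) ((p ^ M : ℕ) : ℤ))
    (hR : ∀ {M : ℕ} (_hM : 1 ≤ M)
        (hdiv : ∀ Q : geomPoints (W.baseChange K), ∃ R, ((p ^ M : ℕ) : ℤ) • R = Q)
        (c : K ≃ₐ[ℚ] K) (_hc : c ≠ 1),
        ∃ (ε : ℤ) (τ : AlgebraicClosure K ≃+* AlgebraicClosure K) (hτ : IsLiftOfAut c τ)
          (A : ℕ → AddSubgroup (geomPoints (W.baseChange K)))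
          (hA : ∀ m, KolyvaginCocycle.IsAdmissible (Field.absoluteGaloisGroup K) (A m)
            ((p ^ M : ℕ) : ℤ))
          (emb : ∀ m : ℕ, ringClassField K ιc m →ₐ[K] AlgebraicClosure K)
          (Pn : ℕ → geomPoints (W.baseChange K))
          (hPn : ∀ m, Pn m ∈
            KolyvaginCocycle.invPoints (Field.absoluteGaloisGroup K) (A m) ((p ^ M : ℕ) : ℤ)),
          (ε = 1 ∨ ε = -1) ∧
          IsOfFinAddOrder (Affine.Point.map (W' := W) (c : K →ₐ[ℚ] K) Pt - ε • Pt) ∧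
          (∀ m, ∀ a ∈ A m, hτ.pointsMap W a ∈ A m) ∧
          Pn 1 = toGeomPoints (W.baseChange K) Pt ∧
          (∀ m, m ≠ 0 → ∀ a ∈ A m, ∀ Φ : Field.absoluteGaloisGroup K,
            (∀ x : ringClassField K ιc m, Φ • emb m x = emb m x) → Φ • a = a) ∧
          (∀ m, ∀ a ∈ A m, ∀ v : HeightOneSpectrum (𝓞 K), ((p : ℕ) : 𝓞 K) ∈ v.asIdeal →
            n' • pointsMap (W.baseChange K) (v.adicCompletion K) a ∈ E0Receptacle (W.baseChange K) v) ∧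
          (∀ m : ℕ, Squarefree m →
            (∀ q ∈ m.primeFactors,
              IsKolyvaginPrime (W.conductorNorm ℤ) W K p q ∧ FrobEqFrobInfty W K (p ^ M) q) →
            (∃ B ∈ A m, hτ.pointsMap W (Pn m) =
              (ε * (-1) ^ m.primeFactors.card) • Pn m + ((p ^ M : ℕ) : ℤ) • B) ∧
            (∀ ℓ : ℕ, ℓ.Prime → ℓ ∣ m → ∀ v : HeightOneSpectrum (𝓞 K), (ℓ : 𝓞 K) ∈ v.asIdeal →
              ∀ a : ℕ, (((p : ℤ) ^ a) •
                  kolyvaginClass (W.baseChange K) _ hdiv (hA m) (Pn m) (hPn m) ∈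
                  selmerLocalKer (W.baseChange K) (v.adicCompletion K) ((p ^ M : ℕ) : ℤ) ↔
                ((p : ℤ) ^ a) • kolyvaginClass (W.baseChange K) _ hdiv (hA (m / ℓ)) (Pn (m / ℓ))
                    (hPn (m / ℓ)) ∈
                  (W.baseChange K).torsionLocalKer (v.adicCompletion K) ((p ^ M : ℕ) : ℤ))) ∧
            (∃ A' : AddSubgroup (geomPoints (W.baseChange K)), A m ≤ A' ∧
              KolyvaginCocycle.IsAdmissible (Field.absoluteGaloisGroup K) A' ((p ^ M : ℕ) : ℤ) ∧
              ∃ R ∈ A', ((p ^ min M t : ℕ) : ℤ) • R = Pn m)))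
    [Finite (W.baseChange K).sha] :
    padicValNat p (Nat.card (W.baseChange K).sha) + 2 * t ≤
      2 * padicValNat p (AddSubgroup.zmultiples Pt).index := by
  refine padicValNat_card_sha_add_le_of_ringClassRationalEprimePoints W hK ιc hp2 hρ hnt hidx t hn' hL ?_
  intro M hM hdiv c hc
  obtain ⟨ε, τ, hτ, A, hA, emb, Pn, hPn, hε, h53, hAτ, hPn1, hrat, hE0, hm⟩ := hR hM hdiv c hc
  refine ⟨ε, τ, hτ, A, hA, emb, Pn, hPn, hε, h53, hAτ, hPn1, hrat, hE0, fun m hsq hq ↦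
    ⟨(hm m hsq hq).1, (hm m hsq hq).2.1, ?_⟩⟩
  obtain ⟨A', hAA', hA', hD⟩ := (hm m hsq hq).2.2
  exact pow_sub_zsmul_kolyvaginClass_eq_zero_of_pointDiv_of_le (W.baseChange K) hAA' (hA m) hA' (hPn m) hD

end Summit.BirchSwinnertonDyer.BirchSwinnertonDyer.Theorems.GenusSharpKolyvagin

end
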